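import Literature.NumberTheory.QuadraticFields.ImaginaryQuadraticPrescribedSplitting
import Literature.NumberTheory.EllipticCurves.NoConductorOne
import Literature.NumberTheory.EllipticCurves.NonEisensteinPrimeOfSurjective
import Literature.NumberTheory.EllipticCurves.HeegnerPoints
import Literature.NumberTheory.EllipticCurves.Rank1Residual.Predicates
import Literature.NumberTheory.DiophantineGeometry.Conductor
import Mathlib.NumberTheory.LSeries.PrimesInAP
import Mathlib.NumberTheory.LegendreSymbol.QuadraticReciprocity
import HarnessLib

/-!
# Route `TwoAdicConverse` (rung S3), crux `OrdLambdaHalfAtTwo` (item stmt-BirchSwinnertonDyer-19556), line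
# `xi_dominant_klingen_two` (habitat S₃), stub `stub_supplyAtTwo`: the FIELD CHOICE of the `ξ`-datum — an imaginary
# quadratic `K = ℚ(√-q)` with `2` split, `(N_E, d_K) = 1`, and a prime of `N_E` NOT split in `K`

Cell `bsd-2adic`, seat `bsd-2adic-conv-1` GEN 27 (`--supports` stmt-BirchSwinnertonDyer-19556, helper).  The datum `XiDatum` of
`Cruxes/OrdLambdaHalfAtTwo/Lines/xi_dominant_klingen_two.lean` wants (fields `isImaginaryQuadratic`, `split`, `coprime`,
`exists_nonsplit`): an imaginary quadratic `K` in which `2` splits, with `d_K` prime to the conductor `N_E`, and some prime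
`ℓ ∣ N_E` that does NOT split in `K` (BSTW's hypothesis (spl)).  The tree's field-supply theorems
(`Quadratic.exists_imaginaryQuadratic_forall_split`, `SignedBaseChangeK1FrameData.exists_field`,
`TwoAdicGreenbergTwist.exists_greenbergField`) prescribe SPLIT primes only; this file adds one NON-split prime:

* `exists_prime_gt_seven_mod_eight_legendreSym_eq_neg_one` — for an odd prime `ℓ` and any bound: a prime `q > n` with
  `q ≡ 7 (mod 8)` and `(-q / ℓ) = -1` (a non-square class mod `ℓ`, CRT with `7 mod 8`, Dirichlet);
* `exists_xiField` — for a globally minimal elliptic `W/ℚ` with `2 ∤ N_E`: a field `K` with `d_K = -q`, `q` prime,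
  `q ≡ 7 (mod 8)`, `q > 2 N_E` (so `q ∤ 2N_E`: `K` ramifies only at the GOOD odd prime `q`, the input of
  `TwoAdicXiSupply.irrK_framed_of_surj_of_discr`), `K` imaginary quadratic, `2` split, `(N_E, d_K) = 1`, and an odd
  prime `ℓ ∣ N_E` (`N_E ≠ 1`: no curve over `ℚ` has everywhere good reduction, tree `conductorNorm_ne_one`) inert in `K`.

HONEST FRAMING.  Dirichlet + quadratic-residue bookkeeping; closes nothing by itself; BSD is not proved by any of this.
PARTITION (D-0054): none — RANK axis S3 × X5@2 stratum S₃ (supply).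

References: Ireland–Rosen, *A Classical Introduction to Modern Number Theory*, Ch. 5, §13.1, Ch. 16 §1 [IrelandRosen1990];
Marcus, *Number Fields*, Ch. 3 Thm. 25 [Marcus2018]; BSTW arXiv:2409.01350 §9.4 (spl) [BurungaleSkinnerTianWan2024].
-/

-- D-0017: single-problem summit, the namespace repeats the problem name by design.
set_option linter.dupNamespace false
set_option autoImplicit false

noncomputable section

open scoped Classical

open NumberField IsDedekindDomain Ideal WeierstrassCurve
  Literature.NumberTheory.EllipticCurves Literature.NumberTheory.QuadraticFields

namespace Summit.BirchSwinnertonDyer.BirchSwinnertonDyer.Theorems.TwoAdicXiSupply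

/-! ## §1 A prime `q ≡ 7 (mod 8)` which is a prescribed non-residue -/

/-- **Dirichlet with a non-residue condition.**  For an odd prime `ℓ` and a bound `n` there is a prime `q > n` with
`q ≡ 7 (mod 8)` and Legendre symbol `(-q / ℓ) = -1`: choose a non-square `a₀ mod ℓ`, solve `k ≡ 7 (mod 8)`,
`k ≡ -a₀ (mod ℓ)` (CRT), and take a prime `q ≡ k (mod 8ℓ)` (Dirichlet, Mathlib `Nat.forall_exists_prime_gt_and_zmodEq`).
[folklore] -/
theorem exists_prime_gt_seven_mod_eight_legendreSym_eq_neg_one {ℓ : ℕ} [Fact ℓ.Prime] (hℓ2 : ℓ ≠ 2) (n : ℕ) :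
    ∃ q : ℕ, q.Prime ∧ n < q ∧ q % 8 = 7 ∧ legendreSym ℓ (-(q : ℤ)) = -1 := by
  have hℓ : ℓ.Prime := Fact.out
  have hodd : Odd ℓ := hℓ.odd_of_ne_two hℓ2
  -- a non-square `a₀` modulo `ℓ`
  obtain ⟨a₀, ha₀⟩ := FiniteField.exists_nonsquare (F := ZMod ℓ) (by rw [ZMod.ringChar_zmod_n]; exact hℓ2)
  have ha₀0 : a₀ ≠ 0 := fun h ↦ ha₀ (h ▸ IsSquare.zero)
  set b : ℕ := (-a₀).val with hb
  have hbℓ : b < ℓ := ZMod.val_lt _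
  have hb0 : b ≠ 0 := by
    rw [hb, Ne, ZMod.val_eq_zero]; exact neg_ne_zero.mpr ha₀0
  have hbcast : (b : ZMod ℓ) = -a₀ := by rw [hb, ZMod.natCast_zmod_val]
  -- CRT: `k ≡ 7 (mod 8)`, `k ≡ b (mod ℓ)`
  have co : Nat.Coprime 8 ℓ := by
    have h := (Nat.coprime_two_left.mpr hodd).pow_left 3
    simpa using h
  obtain ⟨k, hk8, hkℓ⟩ := Nat.chineseRemainder co 7 b
  -- `k` is prime to `8ℓ`
  have hkodd : Odd k := by
    rw [Nat.odd_iff]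
    have h := hk8
    unfold Nat.ModEq at h
    omega
  have hkℓ' : ¬ ℓ ∣ k := by
    intro hdvd
    have h1 : k % ℓ = 0 := Nat.mod_eq_zero_of_dvd hdvd
    have h2 : b % ℓ = 0 := by
      have h := hkℓ; unfold Nat.ModEq at h; rw [← h]; exact h1
    rw [Nat.mod_eq_of_lt hbℓ] at h2
    exact hb0 h2
  have hcop : IsCoprime (k : ℤ) ((8 * ℓ : ℕ) : ℤ) := by
    rw [Nat.isCoprime_iff_coprime]
    refine Nat.Coprime.mul_right ?_ ?_
    · have h := (Nat.coprime_two_right.mpr hkodd).pow_right 3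
      simpa using h
    · exact ((Nat.Prime.coprime_iff_not_dvd hℓ).mpr hkℓ').symm
  -- Dirichlet
  obtain ⟨q, hqn, hq, hmod⟩ :=
    Nat.forall_exists_prime_gt_and_zmodEq n (q := 8 * ℓ) (a := (k : ℤ)) (mul_ne_zero (by norm_num) hℓ.ne_zero) hcop
  refine ⟨q, hq, hqn, ?_, ?_⟩
  · -- `q ≡ k ≡ 7 (mod 8)`
    have h8 : (q : ℤ) ≡ (k : ℤ) [ZMOD ((8 : ℕ) : ℤ)] :=
      hmod.of_dvd (by exact_mod_cast dvd_mul_right 8 ℓ)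
    have h8' : q ≡ k [MOD 8] := Int.natCast_modEq_iff.mp h8
    have h := h8'.trans hk8
    unfold Nat.ModEq at h
    simpa using h
  · -- `(-q / ℓ) = χ(a₀) = -1`
    have hqℓ : ((q : ℤ) : ZMod ℓ) = ((k : ℤ) : ZMod ℓ) :=
      Quadratic.intCast_zmod_eq_of_modEq_of_dvd hmod (dvd_mul_left ℓ 8)
    have hkb : (k : ZMod ℓ) = (b : ZMod ℓ) := (ZMod.natCast_eq_natCast_iff _ _ _).mpr hkℓ
    have hval : ((-(q : ℤ) : ℤ) : ZMod ℓ) = a₀ := by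
      rw [Int.cast_neg, hqℓ, Int.cast_natCast, hkb, hbcast, neg_neg]
    change quadraticChar (ZMod ℓ) (((-(q : ℤ)) : ℤ) : ZMod ℓ) = -1
    rw [hval]
    exact quadraticChar_neg_one_iff_not_isSquare.mpr ha₀

/-! ## §2 The field of the `ξ`-datum -/

/-- **Field choice for the `ξ`-datum.**  `W/ℚ` globally minimal elliptic with `2 ∤ N_E` (e.g. good at `2`).  There are a
prime `q ≡ 7 (mod 8)` with `q > 2 N_E`, an imaginary quadratic `K` with `d_K = -q` — so `2` splits in `K`, `(N_E, d_K) = 1`,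
and `q ∤ 2 N_E` is a prime of GOOD reduction at which `K` ramifies — and an odd prime `ℓ ∣ N_E` which does NOT split in
`K` (`(d_K / ℓ) = -1`).  `N_E ≠ 1` by the tree's `conductorNorm_ne_one` (Tate: no elliptic curve over `ℚ` has everywhere
good reduction). [folklore] -/
theorem exists_xiField (W : WeierstrassCurve ℚ) [W.IsElliptic] [W.IsGloballyMinimal]
    (h2N : ¬ 2 ∣ W.conductorNorm ℤ) :
    ∃ (K : Type) (_ : Field K) (_ : NumberField K) (q ℓ : ℕ),
      IsImaginaryQuadratic K ∧ q.Prime ∧ q % 8 = 7 ∧ 2 * W.conductorNorm ℤ < q ∧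
        NumberField.discr K = -(q : ℤ) ∧
        ((span {(2 : ℤ)}).primesOver (𝓞 K)).ncard = 2 ∧
        IsCoprime (W.conductorNorm ℤ : ℤ) (NumberField.discr K) ∧
        ℓ.Prime ∧ ℓ ≠ 2 ∧ (ℓ : ℤ) ∣ W.conductorNorm ℤ ∧ ((span {(ℓ : ℤ)}).primesOver (𝓞 K)).ncard ≠ 2 := by
  set N : ℕ := W.conductorNorm ℤ with hN
  have hN1 : N ≠ 1 := WeierstrassCurve.conductorNorm_ne_one W
  -- an odd prime `ℓ ∣ N`
  obtain ⟨ℓ, hℓ, hℓN⟩ := Nat.exists_prime_and_dvd hN1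
  have hℓ2 : ℓ ≠ 2 := by rintro rfl; exact h2N hℓN
  -- the prime `q` and the field
  haveI : Fact ℓ.Prime := ⟨hℓ⟩
  obtain ⟨q, hq, hqn, hq8, hleg⟩ := exists_prime_gt_seven_mod_eight_legendreSym_eq_neg_one hℓ2 (2 * N)
  have hD : ((-(q : ℤ)) % 4 = 1 ∧ Squarefree (-(q : ℤ)) ∧ -(q : ℤ) ≠ 1) ∨
      (4 ∣ -(q : ℤ) ∧ (-(q : ℤ) / 4 % 4 = 2 ∨ -(q : ℤ) / 4 % 4 = 3) ∧ Squarefree (-(q : ℤ) / 4)) := by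
    refine Or.inl ⟨by omega, ?_, by omega⟩
    rw [← Int.squarefree_natAbs]
    simpa using hq.squarefree
  obtain ⟨K, _, _, h2, hdisc⟩ := Quadratic.exists_numberField_discr_eq hD
  have htc : IsTotallyComplex K :=
    Quadratic.isTotallyComplex_of_discr_neg h2 (by rw [hdisc, neg_lt_zero]; exact_mod_cast hq.pos)
  refine ⟨K, inferInstance, inferInstance, q, ℓ, ⟨h2, htc⟩, hq, hq8, hqn, hdisc,
    Quadratic.ncard_primesOver_two_eq_two_of_discr_eq_neg h2 hdisc hq8, ?_, hℓ, hℓ2,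
    Int.natCast_dvd_natCast.mpr hℓN, ?_⟩
  · -- `(N, -q) = 1` since `q > N` is prime
    rw [hdisc, IsCoprime.neg_right_iff, Nat.isCoprime_iff_coprime, Nat.coprime_comm, hq.coprime_iff_not_dvd]
    intro h
    have hNpos : 0 < N := W.conductorNorm_pos_holds
    have := Nat.le_of_dvd hNpos h
    omega
  · -- `ℓ` does not split: `(d_K / ℓ) = -1 ≠ 1`
    rw [Ne, Quadratic.ncard_primesOver_eq_two_iff_legendreSym h2 hℓ2, hdisc, hleg]
    decide

/-- The habitat form: `GoodOrd W 2` gives `2 ∤ N_E` (good reduction at `2`, tree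
`not_dvd_conductorNorm_of_hasGoodReductionAtPrime`), so `exists_xiField` applies. [folklore] -/
theorem not_two_dvd_conductorNorm_of_goodOrd (W : WeierstrassCurve ℚ) [W.IsElliptic] [W.IsGloballyMinimal]
    (hGO : Rank1Residual.GoodOrd W 2) : ¬ 2 ∣ W.conductorNorm ℤ :=
  haveI : Fact (Nat.Prime 2) := ⟨Nat.prime_two⟩
  not_dvd_conductorNorm_of_hasGoodReductionAtPrime W hGO.1

end Summit.BirchSwinnertonDyer.BirchSwinnertonDyer.Theorems.TwoAdicXiSupply

end
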